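import Literature.NumberTheory.Sieve.PolymathGEHPrimeTuples
import Literature.NumberTheory.Sieve.PolymathGEHPiecesPrimes
import Literature.NumberTheory.Sieve.PolymathGEHFamilies
import HarnessLib

/-!
# `GEH[ϑ]` for products of primes from increasing short ranges (Theorem 3.6(ii), the `Σ₃` step)

Trunk AntSieve, tooling toward the named fact `Literature.NumberTheory.Sieve.weakDHL_three_two_of_GEH`
(D. H. J. Polymath, Res. Math. Sci. 1:12 (2014) = arXiv:1407.4897, Theorem 3.2(xii)).  In §4.5 (p. 17)
the discrepancy of `1_{A_{j_1,…,j_r}} = 1_{A_{j_1}} ⋆ ⋯ ⋆ 1_{A_{j_r}}` is controlled by Claim 2.6 with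
`β = 1_{A_{j_r}}` (primes in the last range) and `α` the remaining convolution, for each of the finitely
many (depending on `x`) tuples.  This file packages that application of
`GeneralizedElliottHalberstam.finite_family`: `α = setIndicatorAF (tupleProducts Ps)` (indicator of
the products from the earlier ranges, `|α| ≤ 1`, supported in `(N, 2^r N]`), `β = primePiece m m'`
(`m' ≤ 2m`, Siegel–Walfisz hypothesis from `primePiece_siegelWalfisz_uniform`), scales in
`[x^ε, x^{1−ε}]` with `N m ≍ x` — then every member's discrepancy sum is `≤ C x (log x)^{-A}`
(`gehSum_primeTupleFamily_le`).  Also `primePiece = setIndicatorAF (primes in (m, m'])`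
(`setIndicatorAF_primesIoc`), linking with `setIndicatorAF_tupleProducts_cons`.

## References

* [Polymath8b2014] D. H. J. Polymath, Res. Math. Sci. 1 (2014), Art. 12 = arXiv:1407.4897,
  Claim 2.6 (p. 6), §4.5 (p. 17).
-/

noncomputable section

open Finset Real Filter
open scoped ArithmeticFunction.sigma

namespace Literature.NumberTheory.Sieve

/-- The prime piece is the indicator of the primes in `(m, m']`. [folklore] -/
theorem setIndicatorAF_primesIoc (m m' : ℕ) :
    setIndicatorAF ((Ioc m m').filter Nat.Prime) = primePiece m m' := by
  ext n
  simp only [setIndicatorAF_apply, primePiece_apply, Finset.mem_filter, Finset.mem_Ioc]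
  by_cases h : m < n ∧ n ≤ m' ∧ n.Prime
  · rw [if_pos h, if_pos ⟨⟨⟨h.1, h.2.1⟩, h.2.2⟩, h.2.2.ne_zero⟩]
  · rw [if_neg h, if_neg (fun h' => h ⟨h'.1.1.1, h'.1.1.2, h'.1.2⟩)]

/-- `|setIndicatorAF P n| ≤ 1`. [folklore] -/
theorem abs_setIndicatorAF_le_one (P : Finset ℕ) (n : ℕ) : |setIndicatorAF P n| ≤ 1 := by
  rw [setIndicatorAF_apply]; split_ifs <;> simp

/-- `0 ≤ primePiece ≤ 1`. [folklore] -/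
theorem abs_primePiece_le_one (m m' n : ℕ) : |primePiece m m' n| ≤ 1 := by
  rw [primePiece_apply]; split_ifs <;> simp

/-- **`GEH[ϑ]` for the prime-tuple family** (the `Σ₃` step of §4.5): with the data and hypotheses of the
module docstring, one constant bounds the discrepancy sums `gehSum ϑ (2^r) x N m α β` of all members
`i < T x`, eventually in `x`. [cite: Polymath8b2014, Claim 2.6 and §4.5, p. 17] -/
theorem gehSum_primeTupleFamily_le {θ : ℝ} (hGEH : GeneralizedElliottHalberstam θ) {ε : ℝ} (hε : 0 < ε)
    {A : ℝ} (hA : 0 < A) {r : ℕ} (hr : 1 ≤ r) (T : ℝ → ℕ) (hT : ∀ᶠ x in atTop, 0 < T x)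
    (m m' Nα : ℝ → ℕ → ℕ) (Ps : ℝ → ℕ → List (Finset ℕ))
    (hsuppα : ∀ x i, ∀ n ∈ tupleProducts (Ps x i), Nα x i < n ∧ n ≤ 2 ^ r * Nα x i)
    (hβ : ∀ x i, m x i ≤ m' x i ∧ m' x i ≤ 2 * m x i)
    {C₁ : ℝ} (hC₁ : 1 ≤ C₁)
    (hscales : ∀ᶠ x in atTop, ∀ i < T x,
      x ^ ε ≤ (m x i : ℝ) ∧ (m x i : ℝ) ≤ x ^ (1 - ε) ∧ (m' x i : ℝ) ≤ x ∧
      x ^ ε ≤ (Nα x i : ℝ) ∧ (Nα x i : ℝ) ≤ x ^ (1 - ε) ∧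
      x / C₁ ≤ (Nα x i : ℝ) * m x i ∧ (Nα x i : ℝ) * m x i ≤ C₁ * x) :
    ∃ C : ℝ, ∀ᶠ x in atTop, ∀ i < T x,
      gehSum θ (2 ^ r) x (Nα x i) (m x i) (setIndicatorAF (tupleProducts (Ps x i)))
        (primePiece (m x i) (m' x i)) ≤ C * (x / Real.log x ^ A) := by
  have hK : (1 : ℝ) ≤ 2 ^ r := one_le_pow₀ (by norm_num)
  have h2r : (2 : ℝ) ≤ 2 ^ r := by
    calc (2 : ℝ) = 2 ^ 1 := by norm_num
      _ ≤ 2 ^ r := pow_le_pow_right₀ (by norm_num) hr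
  refine GeneralizedElliottHalberstam.finite_family hGEH hε hA 1 hK T hT
    (fun x i => (Nα x i : ℝ)) (fun x i => (m x i : ℝ))
    (fun x i => setIndicatorAF (tupleProducts (Ps x i))) (fun x i => primePiece (m x i) (m' x i))
    ?h1 ⟨C₁, hC₁, ?h2⟩ ?h3 ?h4 ?h5 ?h6
  case h1 =>
    filter_upwards [hscales] with x hx i hi
    obtain ⟨a1, a2, -, a4, a5, -, -⟩ := hx i hi
    exact ⟨a4, a5, a1, a2⟩
  case h2 =>
    filter_upwards [hscales] with x hx i hi
    obtain ⟨-, -, -, -, -, a6, a7⟩ := hx i hi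
    exact ⟨a6, a7⟩
  case h3 =>
    intro x i n hn
    rw [setIndicatorAF_apply, if_neg]
    rintro ⟨hmem, -⟩
    obtain ⟨hlo, hhi⟩ := hsuppα x i n hmem
    rcases hn with hn | hn
    · have : (Nα x i : ℝ) < n := by exact_mod_cast hlo
      linarith
    · have : (n : ℝ) ≤ 2 ^ r * Nα x i := by exact_mod_cast hhi
      linarith
  case h4 =>
    intro x i n hn
    rw [primePiece_apply, if_neg]
    rintro ⟨hlo, hhi, -⟩
    obtain ⟨_, b2⟩ := hβ x i
    rcases hn with hn | hn
    · have : (m x i : ℝ) < n := by exact_mod_cast hlo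
      linarith
    · have h1 : (n : ℝ) ≤ 2 * m x i := by exact_mod_cast hhi.trans b2
      have h0 : (0 : ℝ) ≤ m x i := Nat.cast_nonneg _
      have : (2 : ℝ) * m x i ≤ 2 ^ r * m x i := mul_le_mul_of_nonneg_right h2r h0
      linarith
  case h5 =>
    filter_upwards [eventually_ge_atTop (Real.exp 1)] with x hx i _ n
    have hx0 : 0 < x := lt_of_lt_of_le (Real.exp_pos 1) hx
    have hlog : 1 ≤ Real.log x := by rwa [Real.le_log_iff_exp_le hx0]
    simp only [pow_one]
    have hbound : ∀ v : ℝ, |v| ≤ 1 → (n ≠ 0 ∨ v = 0) → |v| ≤ (σ 0 n : ℝ) * Real.log x := by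
      intro v hv hn
      rcases Nat.eq_zero_or_pos n with h0 | hpos
      · rcases hn with h | h
        · exact absurd h0 h
        · rw [h, abs_zero, h0]; simp
      · have hσ : (1 : ℝ) ≤ (σ 0 n : ℝ) := by
          have : 1 ≤ σ 0 n := by
            rw [ArithmeticFunction.sigma_zero_apply]
            exact Finset.card_pos.2 ⟨1, Nat.one_mem_divisors.2 hpos.ne'⟩
          exact_mod_cast this
        calc |v| ≤ 1 := hv
          _ ≤ (σ 0 n : ℝ) * Real.log x := by nlinarith
    constructor
    · refine hbound _ (abs_setIndicatorAF_le_one _ n) ?_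
      rcases Nat.eq_zero_or_pos n with h0 | hpos
      · right; rw [h0]; exact ArithmeticFunction.map_zero
      · left; exact hpos.ne'
    · refine hbound _ (abs_primePiece_le_one _ _ n) ?_
      rcases Nat.eq_zero_or_pos n with h0 | hpos
      · right; rw [h0]; exact ArithmeticFunction.map_zero
      · left; exact hpos.ne'
  case h6 =>
    intro B hB
    obtain ⟨C, hC⟩ := primePiece_siegelWalfisz_uniform hε (2 ^ r) hK 1 le_rfl B hB
    refine ⟨C, ?_⟩
    filter_upwards [hC, hscales] with x hxC hxs i hi q r' hq hr' a
    obtain ⟨a1, -, a3, -, -, -, -⟩ := hxs i hi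
    obtain ⟨b1, b2⟩ := hβ x i
    have hm'K : (m' x i : ℝ) ≤ 2 ^ r * m x i := by
      have h1 : (m' x i : ℝ) ≤ 2 * m x i := by exact_mod_cast b2
      have h0 : (0 : ℝ) ≤ m x i := Nat.cast_nonneg _
      have : (2 : ℝ) * m x i ≤ 2 ^ r * m x i := mul_le_mul_of_nonneg_right h2r h0
      linarith
    exact hxC (m x i) (m' x i) a1 b1 hm'K a3 q r' hq hr' a

end Literature.NumberTheory.Sieve
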